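import Summits.BirchSwinnertonDyer.Rank1Residual.P2.KrizLiMordellBasesMembership
import Literature.NumberTheory.EllipticCurves.HeegnerFieldOfDiscriminantProofs
import HarnessLib

/-!
# Cell `bsd-print-cf2` (D-0131 (2) PRINT TIER, leaf CornerF @ `p = 2`), seat ty2 — the Heegner field of a
# (★)-certificate BY NAME: Kriz–Li membership and `BSD(W′, 2)` over `K = ℚ(√D)` for an ARBITRARY certified
# discriminant `D` (composite included) — the four (★)-bases ADDITIVE at `2` (`972d1`, `3888s1`, `1728a1`, `1728v1`)

HONEST FRAMING (cell `bsd-print-cf2`, run/shared/lean/pub/bsd-print-cf2/; verbatim): PARTITION currency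
only — the leaf counts when its class theorem is in the kernel BY NAME; every imported theorem carries its
printed hypotheses verbatim. The leaf is OPEN AS A CLASS; nothing class-wide is closed here; theorems only,
no definition, no named fact.

What this adds. The Kriz–Li door (aside 21366 `InertKrizLiStarDoorOfFactsPlus`, p3's generic
`bsdp_two_of_isIsogenousToKrizLiTwistOfSmallCMBase`) is reached, base by base, through the membership theorems
`isIsogenousToKrizLiTwistOfSmallCMBase_of_curveX` (ty2 g3; p3 for `243a1`, `4563b1`), which are GENERIC in the
Heegner field `K` with binders `hK : IsImaginaryQuadratic K`, `jacobiSym (d_K) q = 1`, `d_K ≡ 1 (mod 8)`. The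
(★)-certificates of the cell (lit g5, 118 TRUE pairs `(E, ℚ(√D))`, `|D| ≤ 800`; ty3's records
`CornerFTwoCertificates.RecordsStarJZeroGood/Bad`, whose kernel recheck yields per record
`D < 0 ∧ D % 8 = 1 ∧ Squarefree D.natAbs ∧ (D/ℓ) = 1` at the odd `ℓ ∣ N`) name the field by `D` alone, and 55 of
the 118 certified pairs (15 of the 31 distinct fields) have COMPOSITE `D` (`−95, −119, −143, −215, −287, −335,
−407, −455, −527, −551, −623, −671, −695, −767, −791`), where the tree so far had `IsImaginaryQuadratic (sqrtField D) ∧ d_K = D` only for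
prime `|D|` (`−23`, `−47`). With `Literature…HeegnerFieldOfDiscriminantProofs` (`d_K(ℚ(√D)) = D` for `D < 0`,
`D ≡ 1 (mod 4)` squarefree — Marcus Ch. 2 Thm. 1) this file states, for each of the four (★)-bases `X` ADDITIVE at `2` (companion of
`KrizLiStarFields.lean`, the five GOOD bases; here `D ≡ 1 (mod 8)` is a binder and the Manin clause rides in `hSD`) and EVERY such `D`:

* `inN_curveX_of_discr_eq` — `d ∈ 𝒩(X, K)` in any quadratic `K` with `d_K = D`, from decidable data on the
  prime factors of `d` phrased with the NUMERAL `D` (`(D/ℓ) = 1`, cube-root count in `𝔽_ℓ`);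
* `isIsogenousToKrizLiTwistOfSmallCMBase_of_curveX_sqrtField` — membership of every `W′` `ℚ`-isogenous to
  `X^{(d)}` or `X^{(D·d)}` over `K = sqrtField D`, from `D % 4 = 1` (or `D % 8 = 1` at the additive bases),
  `Squarefree D.natAbs`, the Heegner symbol `(D/3) = 1`, the DISPLAYED `hSD : HasKrizLiStarDatum X
  (sqrtField D)`, and `d ∈ 𝒩`, `d > 0`, `d ≡ 1 (mod 12)`;
* `bsdp_two_of_isIsogenous_twist_curveX_sqrtField` — hence `BSD(W′, 2)` for every globally minimal such `W′`,
  granted BY NAME the seven facts `hKL h33 hS31 hBF hmod hGZK hCassels` of aside 21366.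

So a certified star record `(X, D)` together with a certified member `d` is ONE application away from
`BSD(W′, 2)` by name, whatever `D` is. Currency: LITERAL-by-name((★)-certificate displayed as `hSD`); for
`(243a1, −23)` the datum is PRINTED (Table 1). beyond-print theorem: NO.
[cite: KrizLi2019, Thm. 1.12 (FMS Thm. 5.1 (2)), Def. 4.1, §6 Ex. 6.2, Rem. 6.3 and Table 1]

References: [KrizLi2019] Thm 1.12/5.1, Def 4.1, §6; [Marcus2018] Ch. 2 Thm. 1, Ch. 3 Thm. 25;
[CreutzMiller2012] Thm 1.1; [BurungaleFlach2024] Cor 2; [MilneADT2006] Thm I.7.3; HOME/lit/census-g5/STARCERT-TABLE.md.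
-/

noncomputable section

open scoped Classical

open WeierstrassCurve NumberField Literature.NumberTheory.EllipticCurves
  Literature.NumberTheory.EllipticCurves.Rank1Residual
  Literature.NumberTheory.EllipticCurves.ModularForms
  Summit.BirchSwinnertonDyer.Rank1Residual

set_option autoImplicit false

namespace Summit.BirchSwinnertonDyer.Rank1Residual.P2

/-! ## §1 The four (★)-bases ADDITIVE at `2`: `972d1`, `3888s1`, `1728a1`, `1728v1` (`D ≡ 1 (mod 8)`) -/

/-- `d ∈ 𝒩(972d1, K)` in any quadratic `K` with `d_K = D`, from explicit data phrased with `D`.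
[cite: KrizLi2019, Def. 4.1 (FMS) = arXiv Def. 3.1] -/
theorem inN_curve972d1_of_discr_eq {K : Type} [Field K] [NumberField K] (h2 : Module.finrank ℚ K = 2)
    {D : ℤ} (hdK : NumberField.discr K = D) {d : ℤ} (hd4 : d % 4 = 1) (hsq : Squarefree d.natAbs)
    (hprimes : ∀ (ℓ : ℕ) (hℓ : ℓ.Prime), ℓ ∣ d.natAbs → haveI : NeZero ℓ := ⟨hℓ.ne_zero⟩;
      ℓ ≠ 2 ∧ ℓ ≠ 3 ∧ jacobiSym D ℓ = 1 ∧ Even ((Finset.univ.filter fun x : ZMod ℓ => x ^ 3 = -36).card)) :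
    KrizLi2019.InN curve972d1 K d := by
  subst hdK
  exact inN_curve972d1_of_explicit h2 hd4 hsq hprimes

/-- **`972d1` (`y² = x³ + 36`) over `K = ℚ(√D)`, ANY certified `D`**: `D < 0`, `D ≡ 1 (mod 8)` (`2` splits),
`|D|` square-free, `(D/3) = 1`, (★) displayed (incl. the Manin clause); `d ∈ 𝒩`, `d > 0`, `d ≡ 1 (mod 12)`
(certified at the sixteen `D` of the `243a1 = 972d1 = 3888s1` list, seven composite).
[cite: KrizLi2019, Thm. 5.1 (2), Def. 4.1, §6 Ex. 6.2] [cite: Marcus2018, Ch. 2 Thm. 1] -/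
theorem isIsogenousToKrizLiTwistOfSmallCMBase_of_curve972d1_sqrtField {D : ℤ} [Fact (D < 0)]
    (hD8 : D % 8 = 1) (hsf : Squarefree D.natAbs) (h3 : jacobiSym D 3 = 1)
    (hSD : HasKrizLiStarDatum curve972d1 (sqrtField D)) {d : ℤ}
    (hd : KrizLi2019.InN curve972d1 (sqrtField D) d) (hd0 : 0 < d) (hd12 : d % 12 = 1)
    {W' : WeierstrassCurve ℚ}
    (hiso : IsIsogenous W' (curve972d1.quadraticTwist (d : ℚ)) ∨
      IsIsogenous W' (curve972d1.quadraticTwist ((D * d : ℤ) : ℚ))) :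
    IsIsogenousToKrizLiTwistOfSmallCMBase W' := by
  obtain ⟨hK, hdK⟩ := isImaginaryQuadratic_and_discr_sqrtField_of_squarefree_natAbs D (by omega) hsf
  refine isIsogenousToKrizLiTwistOfSmallCMBase_of_curve972d1 hK (by rw [hdK]; exact hD8)
    (by rw [hdK]; exact h3) hSD hd hd0 hd12 ?_
  rw [hdK, mul_comm]
  exact hiso

/-- **`BSD(W′, 2)` on the Kriz–Li family of `972d1` over `ℚ(√D)`, any certified `D`.**
[cite: KrizLi2019, Thm. 5.1 (2) and Thm. 4.3] [cite: CreutzMiller2012, Thm. 1.1]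
[cite: BurungaleFlach2024, Thm. 1.1 and Cor. 2] [cite: MilneADT2006, Thm. I.7.3] -/
theorem bsdp_two_of_isIsogenous_twist_curve972d1_sqrtField (hKL : KrizLi2019.thm112_bsdTwo_twist)
    (h33 : KrizLi2019.thm33_rank_twist) (hS31 : bsdTriple_of_analyticRank_le_one_of_conductor_lt)
    (hBF : bsdTriple_of_hasCM_of_L_one_ne_zero) (hmod : hasEntireLFunction_rat)
    (hGZK : rank_eq_analyticRank_of_analyticRank_le_one) (hCassels : bsdRHS_eq_of_isIsogenous)
    {D : ℤ} [Fact (D < 0)] (hD8 : D % 8 = 1) (hsf : Squarefree D.natAbs) (h3 : jacobiSym D 3 = 1)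
    (hSD : HasKrizLiStarDatum curve972d1 (sqrtField D)) {d : ℤ}
    (hd : KrizLi2019.InN curve972d1 (sqrtField D) d) (hd0 : 0 < d) (hd12 : d % 12 = 1)
    (W' : WeierstrassCurve ℚ) [W'.IsElliptic] [W'.IsGloballyMinimal]
    (hiso : IsIsogenous W' (curve972d1.quadraticTwist (d : ℚ)) ∨
      IsIsogenous W' (curve972d1.quadraticTwist ((D * d : ℤ) : ℚ))) : BSDp W' 2 :=
  bsdp_two_of_isIsogenousToKrizLiTwistOfSmallCMBase hKL h33 hS31 hBF hmod hGZK hCassels W'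
    (isIsogenousToKrizLiTwistOfSmallCMBase_of_curve972d1_sqrtField hD8 hsf h3 hSD hd hd0 hd12 hiso)

/-- `d ∈ 𝒩(3888s1, K)` in any quadratic `K` with `d_K = D`, from explicit data phrased with `D`.
[cite: KrizLi2019, Def. 4.1 (FMS) = arXiv Def. 3.1] -/
theorem inN_curve3888s1_of_discr_eq {K : Type} [Field K] [NumberField K] (h2 : Module.finrank ℚ K = 2)
    {D : ℤ} (hdK : NumberField.discr K = D) {d : ℤ} (hd4 : d % 4 = 1) (hsq : Squarefree d.natAbs)
    (hprimes : ∀ (ℓ : ℕ) (hℓ : ℓ.Prime), ℓ ∣ d.natAbs → haveI : NeZero ℓ := ⟨hℓ.ne_zero⟩;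
      ℓ ≠ 2 ∧ ℓ ≠ 3 ∧ jacobiSym D ℓ = 1 ∧ Even ((Finset.univ.filter fun x : ZMod ℓ => x ^ 3 = -48).card)) :
    KrizLi2019.InN curve3888s1 K d := by
  subst hdK
  exact inN_curve3888s1_of_explicit h2 hd4 hsq hprimes

/-- **`3888s1` (`y² = x³ + 48`) over `K = ℚ(√D)`, ANY certified `D`** (`D ≡ 1 (mod 8)`, `(D/3) = 1`).
[cite: KrizLi2019, Thm. 5.1 (2), Def. 4.1, §6 Ex. 6.2] [cite: Marcus2018, Ch. 2 Thm. 1] -/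
theorem isIsogenousToKrizLiTwistOfSmallCMBase_of_curve3888s1_sqrtField {D : ℤ} [Fact (D < 0)]
    (hD8 : D % 8 = 1) (hsf : Squarefree D.natAbs) (h3 : jacobiSym D 3 = 1)
    (hSD : HasKrizLiStarDatum curve3888s1 (sqrtField D)) {d : ℤ}
    (hd : KrizLi2019.InN curve3888s1 (sqrtField D) d) (hd0 : 0 < d) (hd12 : d % 12 = 1)
    {W' : WeierstrassCurve ℚ}
    (hiso : IsIsogenous W' (curve3888s1.quadraticTwist (d : ℚ)) ∨
      IsIsogenous W' (curve3888s1.quadraticTwist ((D * d : ℤ) : ℚ))) :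
    IsIsogenousToKrizLiTwistOfSmallCMBase W' := by
  obtain ⟨hK, hdK⟩ := isImaginaryQuadratic_and_discr_sqrtField_of_squarefree_natAbs D (by omega) hsf
  refine isIsogenousToKrizLiTwistOfSmallCMBase_of_curve3888s1 hK (by rw [hdK]; exact hD8)
    (by rw [hdK]; exact h3) hSD hd hd0 hd12 ?_
  rw [hdK, mul_comm]
  exact hiso

/-- **`BSD(W′, 2)` on the Kriz–Li family of `3888s1` over `ℚ(√D)`, any certified `D`.**
[cite: KrizLi2019, Thm. 5.1 (2) and Thm. 4.3] [cite: CreutzMiller2012, Thm. 1.1]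
[cite: BurungaleFlach2024, Thm. 1.1 and Cor. 2] [cite: MilneADT2006, Thm. I.7.3] -/
theorem bsdp_two_of_isIsogenous_twist_curve3888s1_sqrtField (hKL : KrizLi2019.thm112_bsdTwo_twist)
    (h33 : KrizLi2019.thm33_rank_twist) (hS31 : bsdTriple_of_analyticRank_le_one_of_conductor_lt)
    (hBF : bsdTriple_of_hasCM_of_L_one_ne_zero) (hmod : hasEntireLFunction_rat)
    (hGZK : rank_eq_analyticRank_of_analyticRank_le_one) (hCassels : bsdRHS_eq_of_isIsogenous)
    {D : ℤ} [Fact (D < 0)] (hD8 : D % 8 = 1) (hsf : Squarefree D.natAbs) (h3 : jacobiSym D 3 = 1)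
    (hSD : HasKrizLiStarDatum curve3888s1 (sqrtField D)) {d : ℤ}
    (hd : KrizLi2019.InN curve3888s1 (sqrtField D) d) (hd0 : 0 < d) (hd12 : d % 12 = 1)
    (W' : WeierstrassCurve ℚ) [W'.IsElliptic] [W'.IsGloballyMinimal]
    (hiso : IsIsogenous W' (curve3888s1.quadraticTwist (d : ℚ)) ∨
      IsIsogenous W' (curve3888s1.quadraticTwist ((D * d : ℤ) : ℚ))) : BSDp W' 2 :=
  bsdp_two_of_isIsogenousToKrizLiTwistOfSmallCMBase hKL h33 hS31 hBF hmod hGZK hCassels W'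
    (isIsogenousToKrizLiTwistOfSmallCMBase_of_curve3888s1_sqrtField hD8 hsf h3 hSD hd hd0 hd12 hiso)

/-- `d ∈ 𝒩(1728a1, K)` in any quadratic `K` with `d_K = D`, from explicit data phrased with `D`.
[cite: KrizLi2019, Def. 4.1 (FMS) = arXiv Def. 3.1] -/
theorem inN_curve1728a1_of_discr_eq {K : Type} [Field K] [NumberField K] (h2 : Module.finrank ℚ K = 2)
    {D : ℤ} (hdK : NumberField.discr K = D) {d : ℤ} (hd4 : d % 4 = 1) (hsq : Squarefree d.natAbs)
    (hprimes : ∀ (ℓ : ℕ) (hℓ : ℓ.Prime), ℓ ∣ d.natAbs → haveI : NeZero ℓ := ⟨hℓ.ne_zero⟩;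
      ℓ ≠ 2 ∧ ℓ ≠ 3 ∧ jacobiSym D ℓ = 1 ∧ Even ((Finset.univ.filter fun x : ZMod ℓ => x ^ 3 = -2).card)) :
    KrizLi2019.InN curve1728a1 K d := by
  subst hdK
  exact inN_curve1728a1_of_explicit h2 hd4 hsq hprimes

/-- **`1728a1` (`y² = x³ + 2`) over `K = ℚ(√D)`, ANY certified `D`** (`D ≡ 1 (mod 8)`, `(D/3) = 1`;
certified at the twenty `D` of the `1728a1 = 1728v1` list, eleven composite incl. `−455 = −5·7·13`).
[cite: KrizLi2019, Thm. 5.1 (2), Def. 4.1, §6 Ex. 6.2] [cite: Marcus2018, Ch. 2 Thm. 1] -/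
theorem isIsogenousToKrizLiTwistOfSmallCMBase_of_curve1728a1_sqrtField {D : ℤ} [Fact (D < 0)]
    (hD8 : D % 8 = 1) (hsf : Squarefree D.natAbs) (h3 : jacobiSym D 3 = 1)
    (hSD : HasKrizLiStarDatum curve1728a1 (sqrtField D)) {d : ℤ}
    (hd : KrizLi2019.InN curve1728a1 (sqrtField D) d) (hd0 : 0 < d) (hd12 : d % 12 = 1)
    {W' : WeierstrassCurve ℚ}
    (hiso : IsIsogenous W' (curve1728a1.quadraticTwist (d : ℚ)) ∨
      IsIsogenous W' (curve1728a1.quadraticTwist ((D * d : ℤ) : ℚ))) :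
    IsIsogenousToKrizLiTwistOfSmallCMBase W' := by
  obtain ⟨hK, hdK⟩ := isImaginaryQuadratic_and_discr_sqrtField_of_squarefree_natAbs D (by omega) hsf
  refine isIsogenousToKrizLiTwistOfSmallCMBase_of_curve1728a1 hK (by rw [hdK]; exact hD8)
    (by rw [hdK]; exact h3) hSD hd hd0 hd12 ?_
  rw [hdK, mul_comm]
  exact hiso

/-- **`BSD(W′, 2)` on the Kriz–Li family of `1728a1` over `ℚ(√D)`, any certified `D`.**
[cite: KrizLi2019, Thm. 5.1 (2) and Thm. 4.3] [cite: CreutzMiller2012, Thm. 1.1]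
[cite: BurungaleFlach2024, Thm. 1.1 and Cor. 2] [cite: MilneADT2006, Thm. I.7.3] -/
theorem bsdp_two_of_isIsogenous_twist_curve1728a1_sqrtField (hKL : KrizLi2019.thm112_bsdTwo_twist)
    (h33 : KrizLi2019.thm33_rank_twist) (hS31 : bsdTriple_of_analyticRank_le_one_of_conductor_lt)
    (hBF : bsdTriple_of_hasCM_of_L_one_ne_zero) (hmod : hasEntireLFunction_rat)
    (hGZK : rank_eq_analyticRank_of_analyticRank_le_one) (hCassels : bsdRHS_eq_of_isIsogenous)
    {D : ℤ} [Fact (D < 0)] (hD8 : D % 8 = 1) (hsf : Squarefree D.natAbs) (h3 : jacobiSym D 3 = 1)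
    (hSD : HasKrizLiStarDatum curve1728a1 (sqrtField D)) {d : ℤ}
    (hd : KrizLi2019.InN curve1728a1 (sqrtField D) d) (hd0 : 0 < d) (hd12 : d % 12 = 1)
    (W' : WeierstrassCurve ℚ) [W'.IsElliptic] [W'.IsGloballyMinimal]
    (hiso : IsIsogenous W' (curve1728a1.quadraticTwist (d : ℚ)) ∨
      IsIsogenous W' (curve1728a1.quadraticTwist ((D * d : ℤ) : ℚ))) : BSDp W' 2 :=
  bsdp_two_of_isIsogenousToKrizLiTwistOfSmallCMBase hKL h33 hS31 hBF hmod hGZK hCassels W'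
    (isIsogenousToKrizLiTwistOfSmallCMBase_of_curve1728a1_sqrtField hD8 hsf h3 hSD hd hd0 hd12 hiso)

/-- `d ∈ 𝒩(1728v1, K)` in any quadratic `K` with `d_K = D`, from explicit data phrased with `D`.
[cite: KrizLi2019, Def. 4.1 (FMS) = arXiv Def. 3.1] -/
theorem inN_curve1728v1_of_discr_eq {K : Type} [Field K] [NumberField K] (h2 : Module.finrank ℚ K = 2)
    {D : ℤ} (hdK : NumberField.discr K = D) {d : ℤ} (hd4 : d % 4 = 1) (hsq : Squarefree d.natAbs)
    (hprimes : ∀ (ℓ : ℕ) (hℓ : ℓ.Prime), ℓ ∣ d.natAbs → haveI : NeZero ℓ := ⟨hℓ.ne_zero⟩;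
      ℓ ≠ 2 ∧ ℓ ≠ 3 ∧ jacobiSym D ℓ = 1 ∧ Even ((Finset.univ.filter fun x : ZMod ℓ => x ^ 3 = 2).card)) :
    KrizLi2019.InN curve1728v1 K d := by
  subst hdK
  exact inN_curve1728v1_of_explicit h2 hd4 hsq hprimes

/-- **`1728v1` (`y² = x³ − 2`) over `K = ℚ(√D)`, ANY certified `D`** (`D ≡ 1 (mod 8)`, `(D/3) = 1`).
[cite: KrizLi2019, Thm. 5.1 (2), Def. 4.1, §6 Ex. 6.2] [cite: Marcus2018, Ch. 2 Thm. 1] -/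
theorem isIsogenousToKrizLiTwistOfSmallCMBase_of_curve1728v1_sqrtField {D : ℤ} [Fact (D < 0)]
    (hD8 : D % 8 = 1) (hsf : Squarefree D.natAbs) (h3 : jacobiSym D 3 = 1)
    (hSD : HasKrizLiStarDatum curve1728v1 (sqrtField D)) {d : ℤ}
    (hd : KrizLi2019.InN curve1728v1 (sqrtField D) d) (hd0 : 0 < d) (hd12 : d % 12 = 1)
    {W' : WeierstrassCurve ℚ}
    (hiso : IsIsogenous W' (curve1728v1.quadraticTwist (d : ℚ)) ∨
      IsIsogenous W' (curve1728v1.quadraticTwist ((D * d : ℤ) : ℚ))) :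
    IsIsogenousToKrizLiTwistOfSmallCMBase W' := by
  obtain ⟨hK, hdK⟩ := isImaginaryQuadratic_and_discr_sqrtField_of_squarefree_natAbs D (by omega) hsf
  refine isIsogenousToKrizLiTwistOfSmallCMBase_of_curve1728v1 hK (by rw [hdK]; exact hD8)
    (by rw [hdK]; exact h3) hSD hd hd0 hd12 ?_
  rw [hdK, mul_comm]
  exact hiso

/-- **`BSD(W′, 2)` on the Kriz–Li family of `1728v1` over `ℚ(√D)`, any certified `D`.**
[cite: KrizLi2019, Thm. 5.1 (2) and Thm. 4.3] [cite: CreutzMiller2012, Thm. 1.1]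
[cite: BurungaleFlach2024, Thm. 1.1 and Cor. 2] [cite: MilneADT2006, Thm. I.7.3] -/
theorem bsdp_two_of_isIsogenous_twist_curve1728v1_sqrtField (hKL : KrizLi2019.thm112_bsdTwo_twist)
    (h33 : KrizLi2019.thm33_rank_twist) (hS31 : bsdTriple_of_analyticRank_le_one_of_conductor_lt)
    (hBF : bsdTriple_of_hasCM_of_L_one_ne_zero) (hmod : hasEntireLFunction_rat)
    (hGZK : rank_eq_analyticRank_of_analyticRank_le_one) (hCassels : bsdRHS_eq_of_isIsogenous)
    {D : ℤ} [Fact (D < 0)] (hD8 : D % 8 = 1) (hsf : Squarefree D.natAbs) (h3 : jacobiSym D 3 = 1)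
    (hSD : HasKrizLiStarDatum curve1728v1 (sqrtField D)) {d : ℤ}
    (hd : KrizLi2019.InN curve1728v1 (sqrtField D) d) (hd0 : 0 < d) (hd12 : d % 12 = 1)
    (W' : WeierstrassCurve ℚ) [W'.IsElliptic] [W'.IsGloballyMinimal]
    (hiso : IsIsogenous W' (curve1728v1.quadraticTwist (d : ℚ)) ∨
      IsIsogenous W' (curve1728v1.quadraticTwist ((D * d : ℤ) : ℚ))) : BSDp W' 2 :=
  bsdp_two_of_isIsogenousToKrizLiTwistOfSmallCMBase hKL h33 hS31 hBF hmod hGZK hCassels W'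
    (isIsogenousToKrizLiTwistOfSmallCMBase_of_curve1728v1_sqrtField hD8 hsf h3 hSD hd hd0 hd12 hiso)

end Summit.BirchSwinnertonDyer.Rank1Residual.P2

end
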